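import Summits.AtomisticToContinuum.Crystallization.Theorems.OverbindingBudgetAffineFarLayerMainA

/-!
# Far layers |k| ≥ 4 of both window sums in closed form on the Gram chart (31280 Z2, ρ₁ = 1/10 package): determinants, homogeneity, X-dictionary, far rows — part 2 of 2 (sequel of `…OverbindingBudgetAffineFarLayerMainA`)

Split for the 400-line cap by the landing lane (hand-2 g33); the module docstring of part 1 (`…OverbindingBudgetAffineFarLayerMainA`) describes the whole node.  Same namespace; all FQNs unchanged.
0 sorry; standard axioms.
-/

noncomputable section
open Set Module
open scoped Real InnerProductSpace

namespace Summit.AtomisticToContinuum.Crystallization.Theorems.OverbindingBudgetAffineFarLayerMain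
open Literature.MathematicalPhysics.StatisticalMechanics Literature.Algebra.EuclideanLattices
  Literature.Analysis.FunctionSpaces
open Summit.AtomisticToContinuum.Crystallization.Theorems.OverbindingBudgetAffineFarSmoothSplit
open Summit.AtomisticToContinuum.Crystallization.Theorems.OverbindingBudgetAffineRadialChart

local notation "E3" => EuclideanSpace ℝ (Fin 3)
local notation "E5" => EuclideanSpace ℝ (Fin 5)

/-! ## §4 ★★ The far layers `|k| ≥ 4` of both window sums, in closed form on the chart

ONE certified dual-Bessel row per exponent (tree `DualRow`, `R.check = true`, on a box of the NORMALISED planar Gram entries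
`(1, ½ + y₀, 1 + y₂)`, `y = gramChart X`) and a height floor `δlo` (`δlo²·det G_∥(y) ≤ det G(y)`) turn the tree's uniform far
enclosure (`…FarWindow.windowSixUp_le_near_add_far` / `near_add_far_le_windowTwelveLo`, applied to the normalised map `X̂` with the
EXACT height and area of `X̂`) into: far layers of `s⁶·T₃↑` `≤ M₆(y) +` geometric remainder, far layers of `s¹²·T₆↓` `≥ M₁₂(N,y) −`
geometric remainder.  The main terms are FUNCTIONS OF THE CHART POINT ALONE; only the (tiny, certified) remainders are constants. -/

section FarLayers

variable {θ' : ℝ} {w : Fin 6 → ℤ} {X : E3 →ₗ[ℝ] E3}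

/-- ★★ **The far layers of `s⁶·T₃↑` are below the closed-form main term plus ONE row's remainder.**  For the data of a far
window (`θ = 1/25`), a certified row `R` with `μ = 2` whose box contains the normalised planar Gram entries of `X`, a height
floor `0 < δlo` with `δlo²·det G_∥ ≤ det G` at `y = gramChart X` and `R.dlo ≤ 4δlo`, and `e^{−2πδlo r₀} ≤ Q < 1`:
`chartScale X⁶ · (T₃↑(w,X) − Σ_{|k|≤3} layerSum X 6 k ℓ_k) ≤ M₆(gramChart X) + 2·(π/√Dlo)·bound/(1 − Q)`. [this file] -/
theorem far_six_le_farMainSix (hX : FarWindowData (1 / 25) θ' w X) (R : DualRow) (hR : R.check = true)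
    (hμ : R.μ + 1 = 3) (hbd : 0 ≤ R.bound)
    (h00 : (R.g00lo : ℝ) ≤ 1 ∧ (1 : ℝ) ≤ R.g00hi)
    (h01 : (R.g01lo : ℝ) ≤ 1 / 2 + gramChart X 0 ∧ 1 / 2 + gramChart X 0 ≤ R.g01hi)
    (h11 : (R.g11lo : ℝ) ≤ 1 + gramChart X 2 ∧ 1 + gramChart X 2 ≤ R.g11hi)
    {δlo : ℝ} (hδlo : 0 < δlo) (hδ : δlo ^ 2 * detPar (gramChart X) ≤ detFull (gramChart X))
    (hdlo : (R.dlo : ℝ) ≤ 4 * δlo) {r₀ : ℚ} (hr₀ : 0 ≤ r₀) (hr : r₀ ^ 2 * (R.g00hi + R.g11hi) ≤ 1)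
    {Q : ℝ} (hQ : Real.exp (-(2 * π * δlo * r₀)) ≤ Q) (hQ1 : Q < 1) :
    chartScale X ^ 6 * (windowSixUp w X - ∑ k ∈ Finset.Ioo (-4 : ℤ) 4, layerSum X 6 k (windowLabel w k)) ≤
      farMainSix (gramChart X) + 2 * (π / Real.sqrt R.Dlo * R.bound * (1 / (1 - Q))) := by
  have hs : 0 < chartScale X := scale_pos_of_farWindowData (by norm_num) hX
  have hs' := hs.ne'
  letI : MeasurableSpace (Submodule.span ℝ
      (Set.range ![unitMap X (triangularVec₁ 1), unitMap X (triangularVec₂ 1)])) := borel _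
  haveI : BorelSpace (Submodule.span ℝ
      (Set.range ![unitMap X (triangularVec₁ 1), unitMap X (triangularVec₂ 1)])) := ⟨rfl⟩
  -- row facts
  have hR' := hR
  simp only [DualRow.check, Bool.and_eq_true, decide_eq_true_eq, List.all_eq_true, Bool.or_eq_true] at hR'
  obtain ⟨⟨⟨⟨⟨⟨⟨⟨⟨⟨⟨⟨⟨⟨⟨⟨⟨⟨-, -⟩, hg00⟩, hg11⟩, -⟩, -⟩, -⟩, hDlo⟩, -⟩, -⟩, -⟩, -⟩, -⟩, -⟩, -⟩, -⟩, -⟩,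
    -⟩, -⟩ := hR'
  -- Gram facts of the normalised map; positivity of the planar determinant from the row
  have g00 := normSq_unit_t₁ hs'
  have g01 := inner_unit_t₁_t₂ hs'
  have g11 := normSq_unit_t₂ hs'
  have hq : ((R.Dlo : ℚ) : ℝ) ≤ detPar (gramChart X) := by
    have h := R.Dlo_le hg00.le hg11.le h00.1 h01 h11.1
    unfold detPar; linarith
  have hDlo' : (0 : ℝ) < R.Dlo := by exact_mod_cast hDlo
  have hq0 : 0 < detPar (gramChart X) := lt_of_lt_of_le hDlo' hq
  -- the exact height of the normalised map
  have hhq := heightSq_unit_mul_detPar hs'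
  set δh := ‖unitMap X (layerNormal (Real.sqrt (2 / 3))) - (Submodule.span ℝ
        (Set.range ![unitMap X (triangularVec₁ 1), unitMap X (triangularVec₂ 1)])).starProjection
          (unitMap X (layerNormal (Real.sqrt (2 / 3))))‖ with hδh_def
  have hδh0 : 0 ≤ δh := norm_nonneg _
  have hδloh : δlo ≤ δh := by
    have h1 : δlo ^ 2 ≤ δh ^ 2 := le_of_mul_le_mul_right (hδ.trans (le_of_eq hhq.symm)) hq0
    have h2 := Real.sqrt_le_sqrt h1
    rwa [Real.sqrt_sq hδlo.le, Real.sqrt_sq hδh0] at h2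
  have hδpos : 0 < δh := lt_of_lt_of_le hδlo hδloh
  -- the tree's uniform far enclosure for `X̂` with EXACT height and area
  have hinj := injective_unitMap hX
  have hD := gramDet_unit_eq_detPar hs'
  have hdlo' : (R.dlo : ℝ) ≤ 4 * δh := hdlo.trans (by linarith)
  have hr₀' : (0 : ℝ) ≤ r₀ := by exact_mod_cast hr₀
  have hQ' : Real.exp (-(2 * π * δh * r₀)) ≤ Q := by
    refine le_trans (Real.exp_le_exp.2 ?_) hQ
    have hπ := Real.pi_pos
    nlinarith [mul_nonneg (mul_nonneg hπ.le hr₀') (sub_nonneg.2 hδloh)]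
  have key := (windowSixUp_le_near_add_far w (unitMap X) hinj R hR hbd (by rw [g00]; exact h00)
    (by rw [g01]; exact h01) (by rw [g11]; exact h11) hδpos le_rfl le_rfl hdlo' hq0 (le_of_eq hD.symm) (le_of_eq hD)
    hr₀ hr hQ' hQ1 hμ).2
  -- rescale back to `X`
  have hc : 0 < (chartScale X)⁻¹ := inv_pos.2 hs
  have e6 : ((chartScale X)⁻¹ ^ 6)⁻¹ = chartScale X ^ 6 := by rw [inv_pow, inv_inv]
  have hT : windowSixUp w (unitMap X) = chartScale X ^ 6 * windowSixUp w X := by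
    unfold unitMap; rw [windowSixUp_smul hc, e6]
  have hN : ∑ k ∈ Finset.Ioo (-4 : ℤ) 4, layerSum (unitMap X) 6 k (windowLabel w k) =
      chartScale X ^ 6 * ∑ k ∈ Finset.Ioo (-4 : ℤ) 4, layerSum X 6 k (windowLabel w k) := by
    rw [Finset.mul_sum]
    refine Finset.sum_congr rfl fun k _ => ?_
    unfold unitMap; rw [layerSum_smul hc, e6]
  -- the main-term identity `2·π/(2√q·δ̂⁴)·Z₄' = M₆(y)` via `δ̂²·q = c`
  have hqne : detPar (gramChart X) ≠ 0 := hq0.ne'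
  have hδne : δh ≠ 0 := hδpos.ne'
  have hsq : Real.sqrt (detPar (gramChart X)) ≠ 0 := (Real.sqrt_pos.2 hq0).ne'
  have hM : 2 * (π / (2 * Real.sqrt (detPar (gramChart X)) * δh ^ 4) * (π ^ 4 / 90 - 1393 / 1296)) =
      farMainSix (gramChart X) := by
    unfold farMainSix zetaFourTail
    rw [← hhq]
    field_simp
  rw [hT, hN] at key
  rw [mul_sub]
  linarith

/-- ★★ **The far layers of `s¹²·T₆↓` are above the closed-form main term minus ONE row's remainder.**  Same data with a
certified row of `μ = 5`; for every truncation `N` of the tail: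
`M₁₂(N, gramChart X) − 2·(π/(60√Dlo))·bound/(1 − Q) ≤ chartScale X¹² · (T₆↓(w,X) − Σ_{|k|≤3} layerSum X 12 k ℓ_k)`. [this file] -/
theorem farMainTwelve_le_far_twelve (hX : FarWindowData (1 / 25) θ' w X) (R : DualRow) (hR : R.check = true)
    (hμ : R.μ + 1 = 6) (hbd : 0 ≤ R.bound)
    (h00 : (R.g00lo : ℝ) ≤ 1 ∧ (1 : ℝ) ≤ R.g00hi)
    (h01 : (R.g01lo : ℝ) ≤ 1 / 2 + gramChart X 0 ∧ 1 / 2 + gramChart X 0 ≤ R.g01hi)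
    (h11 : (R.g11lo : ℝ) ≤ 1 + gramChart X 2 ∧ 1 + gramChart X 2 ≤ R.g11hi)
    {δlo : ℝ} (hδlo : 0 < δlo) (hδ : δlo ^ 2 * detPar (gramChart X) ≤ detFull (gramChart X))
    (hdlo : (R.dlo : ℝ) ≤ 4 * δlo) {r₀ : ℚ} (hr₀ : 0 ≤ r₀) (hr : r₀ ^ 2 * (R.g00hi + R.g11hi) ≤ 1)
    {Q : ℝ} (hQ : Real.exp (-(2 * π * δlo * r₀)) ≤ Q) (hQ1 : Q < 1) (N : ℕ) :
    farMainTwelve N (gramChart X) - 2 * (π / (60 * Real.sqrt R.Dlo) * R.bound * (1 / (1 - Q))) ≤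
      chartScale X ^ 12 * (windowTwelveLo w X - ∑ k ∈ Finset.Ioo (-4 : ℤ) 4, layerSum X 12 k (windowLabel w k)) := by
  have hs : 0 < chartScale X := scale_pos_of_farWindowData (by norm_num) hX
  have hs' := hs.ne'
  letI : MeasurableSpace (Submodule.span ℝ
      (Set.range ![unitMap X (triangularVec₁ 1), unitMap X (triangularVec₂ 1)])) := borel _
  haveI : BorelSpace (Submodule.span ℝ
      (Set.range ![unitMap X (triangularVec₁ 1), unitMap X (triangularVec₂ 1)])) := ⟨rfl⟩
  have hR' := hR
  simp only [DualRow.check, Bool.and_eq_true, decide_eq_true_eq, List.all_eq_true, Bool.or_eq_true] at hR'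
  obtain ⟨⟨⟨⟨⟨⟨⟨⟨⟨⟨⟨⟨⟨⟨⟨⟨⟨⟨-, -⟩, hg00⟩, hg11⟩, -⟩, -⟩, -⟩, hDlo⟩, -⟩, -⟩, -⟩, -⟩, -⟩, -⟩, -⟩, -⟩, -⟩,
    -⟩, -⟩ := hR'
  have g00 := normSq_unit_t₁ hs'
  have g01 := inner_unit_t₁_t₂ hs'
  have g11 := normSq_unit_t₂ hs'
  have hq : ((R.Dlo : ℚ) : ℝ) ≤ detPar (gramChart X) := by
    have h := R.Dlo_le hg00.le hg11.le h00.1 h01 h11.1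
    unfold detPar; linarith
  have hDlo' : (0 : ℝ) < R.Dlo := by exact_mod_cast hDlo
  have hq0 : 0 < detPar (gramChart X) := lt_of_lt_of_le hDlo' hq
  have hhq := heightSq_unit_mul_detPar hs'
  set δh := ‖unitMap X (layerNormal (Real.sqrt (2 / 3))) - (Submodule.span ℝ
        (Set.range ![unitMap X (triangularVec₁ 1), unitMap X (triangularVec₂ 1)])).starProjection
          (unitMap X (layerNormal (Real.sqrt (2 / 3))))‖ with hδh_def
  have hδh0 : 0 ≤ δh := norm_nonneg _
  have hδloh : δlo ≤ δh := by
    have h1 : δlo ^ 2 ≤ δh ^ 2 := le_of_mul_le_mul_right (hδ.trans (le_of_eq hhq.symm)) hq0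
    have h2 := Real.sqrt_le_sqrt h1
    rwa [Real.sqrt_sq hδlo.le, Real.sqrt_sq hδh0] at h2
  have hδpos : 0 < δh := lt_of_lt_of_le hδlo hδloh
  have hinj := injective_unitMap hX
  have hD := gramDet_unit_eq_detPar hs'
  have hdlo' : (R.dlo : ℝ) ≤ 4 * δh := hdlo.trans (by linarith)
  have hr₀' : (0 : ℝ) ≤ r₀ := by exact_mod_cast hr₀
  have hQ' : Real.exp (-(2 * π * δh * r₀)) ≤ Q := by
    refine le_trans (Real.exp_le_exp.2 ?_) hQ
    have hπ := Real.pi_pos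
    nlinarith [mul_nonneg (mul_nonneg hπ.le hr₀') (sub_nonneg.2 hδloh)]
  have key := (near_add_far_le_windowTwelveLo w (unitMap X) hinj R hR hbd (by rw [g00]; exact h00)
    (by rw [g01]; exact h01) (by rw [g11]; exact h11) hδpos le_rfl le_rfl hdlo' hq0 (le_of_eq hD.symm) (le_of_eq hD)
    hr₀ hr hQ' hQ1 hμ N).2
  have hc : 0 < (chartScale X)⁻¹ := inv_pos.2 hs
  have e12 : ((chartScale X)⁻¹ ^ 12)⁻¹ = chartScale X ^ 12 := by rw [inv_pow, inv_inv]
  have hT : windowTwelveLo w (unitMap X) = chartScale X ^ 12 * windowTwelveLo w X := by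
    unfold unitMap; rw [windowTwelveLo_smul hc, e12]
  have hN : ∑ k ∈ Finset.Ioo (-4 : ℤ) 4, layerSum (unitMap X) 12 k (windowLabel w k) =
      chartScale X ^ 12 * ∑ k ∈ Finset.Ioo (-4 : ℤ) 4, layerSum X 12 k (windowLabel w k) := by
    rw [Finset.mul_sum]
    refine Finset.sum_congr rfl fun k _ => ?_
    unfold unitMap; rw [layerSum_smul hc, e12]
  have hqne : detPar (gramChart X) ≠ 0 := hq0.ne'
  have hδne : δh ≠ 0 := hδpos.ne'
  have hsq : Real.sqrt (detPar (gramChart X)) ≠ 0 := (Real.sqrt_pos.2 hq0).ne'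
  have hM : 2 * (π / (5 * Real.sqrt (detPar (gramChart X)) * δh ^ 10) *
      ∑ m ∈ Finset.range N, ((((m + 4 : ℕ) : ℝ)) ^ 10)⁻¹) = farMainTwelve N (gramChart X) := by
    unfold farMainTwelve tenTail
    rw [← hhq]
    generalize (∑ m ∈ Finset.range N, ((((m + 4 : ℕ) : ℝ)) ^ 10)⁻¹) = T
    rw [eq_div_iff (by positivity)]
    field_simp
  rw [hT, hN] at key
  rw [mul_sub]
  linarith

/-! ### Packaged form: the X-independent side conditions of a far row, and the y-dependent box containment -/

/-- The X-INDEPENDENT side conditions of a certified far row of exponent index `m = μ + 1` (`3` for the cube sum, `6` for the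
sixth-power sum): the row passes the tree checker, has non-negative bound and a `g00` box containing the pinned value `1`;
`δlo > 0` is a height floor with `R.dlo ≤ 4δlo`; `r₀ ≥ 0` with `r₀²(g00hi + g11hi) ≤ 1`; `e^{−2πδlo r₀} ≤ Q < 1`.
(All decidable / one-line numerics per window; INSTRUMENTABLE.)  A structure of proofs, no data. -/
structure FarRow (R : DualRow) (m : ℕ) (δlo : ℝ) (r₀ : ℚ) (Q : ℝ) : Prop where
  check : R.check = true
  index : R.μ + 1 = m
  bound_nonneg : 0 ≤ R.bound
  g00 : (R.g00lo : ℝ) ≤ 1 ∧ (1 : ℝ) ≤ R.g00hi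
  floor_pos : 0 < δlo
  dlo_le : (R.dlo : ℝ) ≤ 4 * δlo
  r₀_nonneg : 0 ≤ r₀
  r₀_sq_le : r₀ ^ 2 * (R.g00hi + R.g11hi) ≤ 1
  exp_le : Real.exp (-(2 * π * δlo * r₀)) ≤ Q
  lt_one : Q < 1

/-- The y-DEPENDENT box containment of a chart point in a row's box of normalised planar Gram entries:
`g01lo ≤ ½ + y₀ ≤ g01hi`, `g11lo ≤ 1 + y₂ ≤ g11hi` (two slabs of `E5`; CERT·algebraic on an annulus, trivially). -/
structure InRowBox (R : DualRow) (y : E5) : Prop where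
  g01 : (R.g01lo : ℝ) ≤ 1 / 2 + y 0 ∧ 1 / 2 + y 0 ≤ R.g01hi
  g11 : (R.g11lo : ℝ) ≤ 1 + y 2 ∧ 1 + y 2 ≤ R.g11hi

/-- ★★ (upper far layers, packaged) `s⁶·(T₃↑ − window layers) ≤ M₆(y) + 2(π/√Dlo)·bound/(1−Q)` at `y = gramChart X`. [this file] -/
theorem far_six_le_of_farRow (hX : FarWindowData (1 / 25) θ' w X) {R : DualRow} {δlo : ℝ} {r₀ : ℚ} {Q : ℝ}
    (hrow : FarRow R 3 δlo r₀ Q) (hbox : InRowBox R (gramChart X))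
    (hδ : δlo ^ 2 * detPar (gramChart X) ≤ detFull (gramChart X)) :
    chartScale X ^ 6 * (windowSixUp w X - ∑ k ∈ Finset.Ioo (-4 : ℤ) 4, layerSum X 6 k (windowLabel w k)) ≤
      farMainSix (gramChart X) + 2 * (π / Real.sqrt R.Dlo * R.bound * (1 / (1 - Q))) := by
  obtain ⟨hR, hμ, hbd, h00, hδlo, hdlo, hr₀, hr, hQ, hQ1⟩ := hrow
  exact far_six_le_farMainSix hX R hR hμ hbd h00 hbox.1 hbox.2 hδlo hδ hdlo hr₀ hr hQ hQ1

/-- ★★ (lower far layers, packaged) `M₁₂(N,y) − 2(π/(60√Dlo))·bound/(1−Q) ≤ s¹²·(T₆↓ − window layers)` at `y = gramChart X`.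
[this file] -/
theorem le_far_twelve_of_farRow (hX : FarWindowData (1 / 25) θ' w X) {R : DualRow} {δlo : ℝ} {r₀ : ℚ} {Q : ℝ}
    (hrow : FarRow R 6 δlo r₀ Q) (hbox : InRowBox R (gramChart X))
    (hδ : δlo ^ 2 * detPar (gramChart X) ≤ detFull (gramChart X)) (N : ℕ) :
    farMainTwelve N (gramChart X) - 2 * (π / (60 * Real.sqrt R.Dlo) * R.bound * (1 / (1 - Q))) ≤
      chartScale X ^ 12 * (windowTwelveLo w X - ∑ k ∈ Finset.Ioo (-4 : ℤ) 4, layerSum X 12 k (windowLabel w k)) := by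
  obtain ⟨hR, hμ, hbd, h00, hδlo, hdlo, hr₀, hr, hQ, hQ1⟩ := hrow
  exact farMainTwelve_le_far_twelve hX R hR hμ hbd h00 hbox.1 hbox.2 hδlo hδ hdlo hr₀ hr hQ hQ1 N

/-- ★ `e^{−2πδr} ≤ 1/(1 + 6δr + 18(δr)²)` for `δ, r ≥ 0` (`π > 3` and `1 + x + x²/2 ≤ eˣ`): a RATIONAL ceiling `Q` for the far-row geometric
ratio. [Mathlib `Real.pi_gt_three`, `Real.quadratic_le_exp_of_nonneg`] -/
theorem exp_neg_two_pi_le {δ r : ℝ} (hδ : 0 ≤ δ) (hr : 0 ≤ r) :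
    Real.exp (-(2 * π * δ * r)) ≤ 1 / (1 + 6 * (δ * r) + 18 * (δ * r) ^ 2) := by
  have hx : 0 ≤ 6 * (δ * r) := by positivity
  have h1 : Real.exp (-(2 * π * δ * r)) ≤ Real.exp (-(6 * (δ * r))) := by
    apply Real.exp_le_exp.2
    have := Real.pi_gt_three
    nlinarith [mul_nonneg hδ hr]
  have h2 : 1 + 6 * (δ * r) + 18 * (δ * r) ^ 2 ≤ Real.exp (6 * (δ * r)) := by
    have := Real.quadratic_le_exp_of_nonneg hx
    convert this using 1
    ring
  have h3 : 0 < 1 + 6 * (δ * r) + 18 * (δ * r) ^ 2 := by positivity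
  calc Real.exp (-(2 * π * δ * r)) ≤ Real.exp (-(6 * (δ * r))) := h1
    _ = (Real.exp (6 * (δ * r)))⁻¹ := Real.exp_neg _
    _ ≤ (1 + 6 * (δ * r) + 18 * (δ * r) ^ 2)⁻¹ := inv_anti₀ h3 h2
    _ = 1 / (1 + 6 * (δ * r) + 18 * (δ * r) ^ 2) := (one_div _).symm

/-- ★ **`FarRow` from decidable RATIONAL data.**  With a rational height floor `δlo > 0` and radius `r₀ > 0` the geometric ratio may be taken
`Q := 1/(1 + 6δlo r₀ + 18(δlo r₀)²) < 1` (★ `exp_neg_two_pi_le`); every other field is a decidable inequality in `ℚ` (`decide` / `norm_num` per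
row — the rows do NOT depend on the window: the normalised box is the same for all 64 windows).  INSTRUMENTABLE. [this file] -/
theorem farRow_of_rat (R : DualRow) (m : ℕ) {δlo r₀ : ℚ} (hcheck : R.check = true) (hμ : R.μ + 1 = m) (hbd : 0 ≤ R.bound)
    (h00 : R.g00lo ≤ 1 ∧ 1 ≤ R.g00hi) (hδ : 0 < δlo) (hdlo : R.dlo ≤ 4 * δlo) (hr₀ : 0 < r₀)
    (hr : r₀ ^ 2 * (R.g00hi + R.g11hi) ≤ 1) :
    FarRow R m (δlo : ℝ) r₀ (1 / (1 + 6 * ((δlo : ℝ) * r₀) + 18 * ((δlo : ℝ) * r₀) ^ 2)) where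
  check := hcheck
  index := hμ
  bound_nonneg := hbd
  g00 := ⟨by exact_mod_cast h00.1, by exact_mod_cast h00.2⟩
  floor_pos := by exact_mod_cast hδ
  dlo_le := by exact_mod_cast hdlo
  r₀_nonneg := hr₀.le
  r₀_sq_le := hr
  exp_le := exp_neg_two_pi_le (by exact_mod_cast hδ.le) (by exact_mod_cast hr₀.le)
  lt_one := by
    have hp : (0 : ℝ) < (δlo : ℝ) * r₀ := by exact_mod_cast mul_pos hδ hr₀
    have h : (0 : ℝ) < 6 * ((δlo : ℝ) * r₀) + 18 * ((δlo : ℝ) * r₀) ^ 2 := by positivity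
    rw [div_lt_one (by positivity)]
    linarith

end FarLayers

end Summit.AtomisticToContinuum.Crystallization.Theorems.OverbindingBudgetAffineFarLayerMain

end
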